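import Summits.ValiantsHypothesis.ValiantsHypothesis.Theorems.SymPencilPerFourHyperplanePencilRankOneB
import Summits.ValiantsHypothesis.ValiantsHypothesis.Theorems.SymPencilPerFourHyperplanePencilSign
import Summits.ValiantsHypothesis.ValiantsHypothesis.Theorems.SymPencilPerFourBoxNonvanishing

/-!
# Route `SymPencil` — the one-row pencil core of hyperplane flow rigidity, VI: S1c for every `μ`
# with no zero coordinate (tool file, `--supports` stmt-ValiantsHypothesis-5674; nothing here bears
# on `VP ≠ VNP`)

Assembly of stub S1c of cell `(12,4,2)` (memo `Cruxes/SdcSuperquadratic/CELL-TWELVE-FOUR.md` §3/§6)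
for linear forms `μ` on `K⁴` with all `μ(e_j) ≠ 0`:

* `pencil_flow_conj`: the block-diagonal flow
  `per [𝟙; a + tX₀a; b + tX₁b; c + tX₂c] = per [𝟙; a; b; c]` (`c ∈ ker μ`) transports to the
  conjugates `P_σ X_i P_σ⁻¹`, `μ ∘ P_σ⁻¹` along a coordinate permutation `σ`;
* `X₂_eq_zero_of_pencil_flow_nonzero`: PART X (`X₂ = 0` on `ker μ`) for all `μ` with no zero
  coordinate: the generic branch (`…PencilSym`), the pattern `(1,1,−1,−1)` (`…PencilSign`), and the
  patterns `(1,−1,1,−1)`, `(1,−1,−1,1)` by transport with `swap 1 2`, `swap 1 3`;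
* `exists_kernel_hyperplane_of_pencil_flow_nonzero` (S1c for such `μ`, via `…PencilRankOneB`) and
  `exists_good_point_of_pencil_flow_nonzero` (the GOOD POINT of `RIG_𝟙`: `μ c = 0`,
  `X₀ a = X₁ b = X₂ c = 0`, `per [𝟙; a; b; c] ≠ 0`, via LEMMA N `…BoxNonvanishing.exists_box_point`).

Residual of S1c: `μ` with a zero coordinate (memo §6 (b)).  Elementary. [folklore]
-/

-- single-conjunct layout: Sub = Summit, duplicated namespace component intended
set_option linter.dupNamespace false

namespace Summit.ValiantsHypothesis.ValiantsHypothesis.Theorems.SymPencilPerFourHyperplanePencilNonzero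

open Matrix
open Summit.ValiantsHypothesis.ValiantsHypothesis.Theorems.SymPencilPerFourHyperplanePencilSym
  (X₂_eq_zero_of_pencil_flow_generic)
open Summit.ValiantsHypothesis.ValiantsHypothesis.Theorems.SymPencilPerFourHyperplanePencilSign
  (eq_zero_of_pencil_flow_sign₁)
open Summit.ValiantsHypothesis.ValiantsHypothesis.Theorems.SymPencilPerFourHyperplanePencilPerm
open Summit.ValiantsHypothesis.ValiantsHypothesis.Theorems.SymPencilPerFourBoxNonvanishing
  (exists_box_point)

variable {K : Type*} [Field K]

/-! ### Transport of the flow -/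

/-- The pencil flow transports to the conjugates along a coordinate permutation. [folklore] -/
theorem pencil_flow_conj (σ : Equiv.Perm (Fin 4)) (X₀ X₁ X₂ : (Fin 4 → K) →ₗ[K] (Fin 4 → K))
    (μ : (Fin 4 → K) →ₗ[K] K)
    (h : ∀ (a b c : Fin 4 → K) (t : K), μ c = 0 →
      (Matrix.of ![(fun _ => (1 : K)), a + t • X₀ a, b + t • X₁ b, c + t • X₂ c]).permanent =
        (Matrix.of ![(fun _ => (1 : K)), a, b, c]).permanent)
    (a b c : Fin 4 → K) (t : K) (hc : (μ ∘ₗ LinearMap.funLeft K K σ.symm) c = 0) :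
    (Matrix.of ![(fun _ => (1 : K)),
        a + t • (LinearMap.funLeft K K σ ∘ₗ X₀ ∘ₗ LinearMap.funLeft K K σ.symm) a,
        b + t • (LinearMap.funLeft K K σ ∘ₗ X₁ ∘ₗ LinearMap.funLeft K K σ.symm) b,
        c + t • (LinearMap.funLeft K K σ ∘ₗ X₂ ∘ₗ LinearMap.funLeft K K σ.symm) c]).permanent =
      (Matrix.of ![(fun _ => (1 : K)), a, b, c]).permanent := by
  have e : ∀ (X : (Fin 4 → K) →ₗ[K] (Fin 4 → K)) (v : Fin 4 → K),
      v + t • (LinearMap.funLeft K K σ ∘ₗ X ∘ₗ LinearMap.funLeft K K σ.symm) v =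
        ((v ∘ σ.symm) + t • X (v ∘ σ.symm)) ∘ σ := fun X v => by
    rw [conj_apply]; funext p; simp
  have hc' : μ (c ∘ σ.symm) = 0 := hc
  rw [e X₀ a, e X₁ b, e X₂ c, per_comp_perm, h (a ∘ σ.symm) (b ∘ σ.symm) (c ∘ σ.symm) t hc',
    ← per_comp_perm σ (a ∘ σ.symm), comp_symm_comp, comp_symm_comp, comp_symm_comp]

/-- Back-transport of `X₂ = 0` on the hyperplane. [folklore] -/
theorem X₂_eq_zero_of_conj (σ : Equiv.Perm (Fin 4)) (X₂ : (Fin 4 → K) →ₗ[K] (Fin 4 → K))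
    (μ : (Fin 4 → K) →ₗ[K] K)
    (hZ : ∀ c, (μ ∘ₗ LinearMap.funLeft K K σ.symm) c = 0 →
      (LinearMap.funLeft K K σ ∘ₗ X₂ ∘ₗ LinearMap.funLeft K K σ.symm) c = 0)
    (c : Fin 4 → K) (hc : μ c = 0) : X₂ c = 0 := by
  have h := hZ (c ∘ σ) (by rw [LinearMap.comp_apply, funLeft_eq_comp, comp_comp_symm]; exact hc)
  rw [conj_apply, comp_comp_symm] at h
  rw [← comp_comp_symm σ (X₂ c), h]; rfl

variable [CharZero K]

/-! ### PART X for `μ` with no zero coordinate -/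

/-- **`X₂ = 0` on `ker μ`** for every `μ` with all `μ(e_j) ≠ 0`. [folklore] -/
theorem X₂_eq_zero_of_pencil_flow_nonzero (X₀ X₁ X₂ : (Fin 4 → K) →ₗ[K] (Fin 4 → K))
    (μ : (Fin 4 → K) →ₗ[K] K)
    (h : ∀ (a b c : Fin 4 → K) (t : K), μ c = 0 →
      (Matrix.of ![(fun _ => (1 : K)), a + t • X₀ a, b + t • X₁ b, c + t • X₂ c]).permanent =
        (Matrix.of ![(fun _ => (1 : K)), a, b, c]).permanent)
    (hm : ∀ j, μ (Pi.single j 1) ≠ 0) (c : Fin 4 → K) (hc : μ c = 0) : X₂ c = 0 := by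
  by_cases hp₁ : μ (Pi.single 1 1) = μ (Pi.single 0 1) ∧ μ (Pi.single 2 1) = -μ (Pi.single 0 1) ∧
      μ (Pi.single 3 1) = -μ (Pi.single 0 1)
  · exact (eq_zero_of_pencil_flow_sign₁ X₀ X₁ X₂ μ (hm 0) hp₁.1 hp₁.2.1 hp₁.2.2 h).2.2 c hc
  by_cases hp₂ : μ (Pi.single 1 1) = -μ (Pi.single 0 1) ∧ μ (Pi.single 2 1) = μ (Pi.single 0 1) ∧
      μ (Pi.single 3 1) = -μ (Pi.single 0 1)
  · -- transport by `swap 1 2`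
    refine X₂_eq_zero_of_conj (Equiv.swap (1 : Fin 4) 2) X₂ μ (fun c' hc' => ?_) c hc
    have h' := pencil_flow_conj (Equiv.swap (1 : Fin 4) 2) X₀ X₁ X₂ μ h
    refine (eq_zero_of_pencil_flow_sign₁ _ _ _ _ ?_ ?_ ?_ ?_ h').2.2 c' hc'
    · rw [conj_single, Equiv.swap_apply_of_ne_of_ne (by decide) (by decide)]; exact hm 0
    · rw [conj_single, conj_single, Equiv.swap_apply_left,
        Equiv.swap_apply_of_ne_of_ne (by decide) (by decide)]; exact hp₂.2.1
    · rw [conj_single, conj_single, Equiv.swap_apply_right,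
        Equiv.swap_apply_of_ne_of_ne (by decide) (by decide)]; exact hp₂.1
    · rw [conj_single, conj_single, Equiv.swap_apply_of_ne_of_ne (by decide) (by decide),
        Equiv.swap_apply_of_ne_of_ne (by decide) (by decide)]; exact hp₂.2.2
  by_cases hp₃ : μ (Pi.single 1 1) = -μ (Pi.single 0 1) ∧ μ (Pi.single 2 1) = -μ (Pi.single 0 1) ∧
      μ (Pi.single 3 1) = μ (Pi.single 0 1)
  · -- transport by `swap 1 3`
    refine X₂_eq_zero_of_conj (Equiv.swap (1 : Fin 4) 3) X₂ μ (fun c' hc' => ?_) c hc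
    have h' := pencil_flow_conj (Equiv.swap (1 : Fin 4) 3) X₀ X₁ X₂ μ h
    refine (eq_zero_of_pencil_flow_sign₁ _ _ _ _ ?_ ?_ ?_ ?_ h').2.2 c' hc'
    · rw [conj_single, Equiv.swap_apply_of_ne_of_ne (by decide) (by decide)]; exact hm 0
    · rw [conj_single, conj_single, Equiv.swap_apply_left,
        Equiv.swap_apply_of_ne_of_ne (by decide) (by decide)]; exact hp₃.2.2
    · rw [conj_single, conj_single, Equiv.swap_apply_of_ne_of_ne (by decide) (by decide),
        Equiv.swap_apply_of_ne_of_ne (by decide) (by decide)]; exact hp₃.2.1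
    · rw [conj_single, conj_single, Equiv.swap_apply_right,
        Equiv.swap_apply_of_ne_of_ne (by decide) (by decide)]; exact hp₃.1
  exact X₂_eq_zero_of_pencil_flow_generic X₀ X₁ X₂ μ h hm hp₁ hp₂ hp₃ c hc

/-- **S1c for `μ` with no zero coordinate**: the pencil flow forces `X₀, X₁` to vanish on a common
hyperplane (or identically) and `X₂` to vanish on `ker μ`. [folklore] -/
theorem exists_kernel_hyperplane_of_pencil_flow_nonzero (X₀ X₁ X₂ : (Fin 4 → K) →ₗ[K] (Fin 4 → K))
    (μ : (Fin 4 → K) →ₗ[K] K)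
    (h : ∀ (a b c : Fin 4 → K) (t : K), μ c = 0 →
      (Matrix.of ![(fun _ => (1 : K)), a + t • X₀ a, b + t • X₁ b, c + t • X₂ c]).permanent =
        (Matrix.of ![(fun _ => (1 : K)), a, b, c]).permanent)
    (hm : ∀ j, μ (Pi.single j 1) ≠ 0) :
    ∃ φ : (Fin 4 → K) →ₗ[K] K,
      (∀ a, φ a = 0 → X₀ a = 0 ∧ X₁ a = 0) ∧ (∀ c, μ c = 0 → X₂ c = 0) :=
  SymPencilPerFourHyperplanePencilRankOneB.exists_kernel_hyperplane_of_X₂_eq_zero X₀ X₁ X₂ μ h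
    (X₂_eq_zero_of_pencil_flow_nonzero X₀ X₁ X₂ μ h hm)

/-- **The good point of `RIG_𝟙` for `μ` with no zero coordinate**: there are `a, b` and
`c ∈ ker μ` with `X₀ a = X₁ b = X₂ c = 0` and `per [𝟙; a; b; c] ≠ 0`. [folklore] -/
theorem exists_good_point_of_pencil_flow_nonzero (X₀ X₁ X₂ : (Fin 4 → K) →ₗ[K] (Fin 4 → K))
    (μ : (Fin 4 → K) →ₗ[K] K)
    (h : ∀ (a b c : Fin 4 → K) (t : K), μ c = 0 →
      (Matrix.of ![(fun _ => (1 : K)), a + t • X₀ a, b + t • X₁ b, c + t • X₂ c]).permanent =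
        (Matrix.of ![(fun _ => (1 : K)), a, b, c]).permanent)
    (hm : ∀ j, μ (Pi.single j 1) ≠ 0) :
    ∃ a b c : Fin 4 → K, μ c = 0 ∧ X₀ a = 0 ∧ X₁ b = 0 ∧ X₂ c = 0 ∧
      (Matrix.of ![(fun _ => (1 : K)), a, b, c]).permanent ≠ 0 := by
  obtain ⟨φ, hφ, hZ⟩ := exists_kernel_hyperplane_of_pencil_flow_nonzero X₀ X₁ X₂ μ h hm
  obtain ⟨a, b, c, ha, hb, hc, hper⟩ := exists_box_point φ φ μ
  exact ⟨a, b, c, hc, (hφ a ha).1, (hφ b hb).2, hZ c hc, hper⟩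

end Summit.ValiantsHypothesis.ValiantsHypothesis.Theorems.SymPencilPerFourHyperplanePencilNonzero
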